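import Summits.NavierStokesRegularity.NavierStokesRegularity.Theorems.TypeICertificateLadderTargetFlowwiseDepletionEventualRung
import HarnessLib

/-!
# Route `ExtremiserTransience`, support item `AveragedRung` (stmt-NavierStokesRegularity-21885), slab step:
# the depleted enstrophy Grönwall against the Type-I rate with a LOG-TIME QUADRATIC-MEAN depletion coefficient

`--supports stmt-NavierStokesRegularity-21885` (route `ExtremiserTransience`, D-0145 ideator line of the
LADDER-NS hard core N0 / stmt-1217 `ThreadingFlux.Target`; director-ns 2026-08-27T17:57Z «ceiling_lift = a
NON-constant-form input»). Author: the STA lineage `ns-sta-19551-p1` (g10), whose constant-form depletion ladder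
(`…StrainCube*`: reach `C < 18 − 9√3`, ceiling `C < 200/13` BY THEOREM) this line is designed to lift.

**Content.** The landed rungs consume a CONSTANT depletion coefficient `κ`
(`|∫⟪ω, Du ω⟫| ≤ κ·M·‖ω‖₂·‖∇ω‖₂` at every late time; `…FlowwiseDepletionEventualRung`). The enstrophy
Grönwall only ever integrates `k(t)²‖u(t)‖²_∞ ≤ k(t)²C²ν/(T−t)` in time, so what it really needs is the
LOG-TIME QUADRATIC MEAN of a flow-wise coefficient `k(t)`: if `∫_{t₁}^t k(τ)² dτ/(T−τ) ≤ r² log((T−t₁)/(T−t)) + B`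
then the enstrophy grows at most like `(T−t)^{−r²C²/2}`.

* `intervalIntegrable_coeff_sq_div`, `lintegral_Ioc_coeff_le_of_logMean` — bookkeeping of the weight
  `k(s)²/(T−s)` for a measurable `k ∈ [0,1]` (integrable on compact sub-intervals of `(−∞,T)`; the log-mean
  hypothesis in lower-Lebesgue form).
* `lintegral_curl_sq_le_rpow_of_rate_logMean` — **the slab step**: classical Leray–Hopf rapidly-decaying-datum
  solution on `[0,T)`, eventual rate `√(T−t)‖u‖ ≤ C√ν`, measurable flow-wise coefficient `k ∈ [0,1]` from an
  onset `t₁` with log-time quadratic mean `≤ r` ⇒ `∫‖curl u(t)‖² ≤ K (T−t)^{−r²C²/2}` on `(0,T)` (the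
  time-dependent-coefficient slab Grönwall `lintegral_curl_sq_le_exp_of_flowwise_coeff` with coefficient `1` =
  Cauchy–Schwarz before a late onset and `k` after; weight integral
  `≤ B₀²T + C²ν(log(T/(T−t₁)) + max B 0 + r² log(T/(T−t)))`).

The rung itself (`r·C < 1` ⇒ extension) and the item by name are in `…ExtremiserTransienceAveragedRung.lean`.
WHAT THIS IS NOT: no depletion (constant or mean) is proved; a conditional growth bound. Elementary given the
landed chain. References: Leray 1934 §§19–20; Lemarié-Rieusset (2016), Thm. 11.2; Robinson–Rodrigo–Sadowski
(2016), Lemma 8.16; T. Tao, arXiv:1108.1165, Thm. 5.4. [folklore]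
-/

noncomputable section

open Set Filter Topology MeasureTheory
open scoped RealInnerProductSpace ENNReal NNReal ContDiff
open Literature.Analysis.FluidPDE

namespace Summit.NavierStokesRegularity.NavierStokesRegularity.Theorems.DepletionLadder

-- the problem directory repeats the summit name (`NavierStokesRegularity/NavierStokesRegularity`)
set_option linter.dupNamespace false

open Summit.NavierStokesRegularity.NavierStokesRegularity.Theorems.RungReynoldsOne

/-- Integrability of the log-time weight `k(s)²/(T−s)` of a measurable coefficient `k ∈ [0,1]` on a
compact interval `[a, b] ⊂ (−∞, T)`: it is measurable and bounded by `1/(T−b)`. [folklore] -/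
theorem intervalIntegrable_coeff_sq_div {k : ℝ → ℝ} {T a b : ℝ} (hkm : Measurable k)
    (hk01 : ∀ τ, 0 ≤ k τ ∧ k τ ≤ 1) (hab : a ≤ b) (hbT : b < T) :
    IntervalIntegrable (fun s => k s ^ 2 / (T - s)) volume a b := by
  rw [intervalIntegrable_iff_integrableOn_Ioc_of_le hab]
  have hmeas : Measurable fun s => k s ^ 2 / (T - s) :=
    (hkm.pow_const 2).div (measurable_const.sub measurable_id)
  refine IntegrableOn.of_bound (measure_Ioc_lt_top) hmeas.aestronglyMeasurable (1 / (T - b)) ?_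
  refine (ae_restrict_mem measurableSet_Ioc).mono fun s hs => ?_
  have hTs : 0 < T - s := by linarith [hs.2]
  have hk2 : k s ^ 2 ≤ 1 := by
    have h := hk01 s
    nlinarith [h.1, h.2]
  rw [Real.norm_eq_abs, abs_of_nonneg (div_nonneg (sq_nonneg _) hTs.le)]
  calc k s ^ 2 / (T - s) ≤ 1 / (T - s) := div_le_div_of_nonneg_right hk2 hTs.le
    _ ≤ 1 / (T - b) := one_div_le_one_div_of_le (by linarith) (by linarith [hs.2])

/-- The lower-Lebesgue form of the log-mean hypothesis on a late interval: for `t₁ < t < T`,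
`∫⁻_{(t₁,t]} ofReal(c · k(s)²/(T−s)) ≤ ofReal(c · (r² log((T−t₁)/(T−t)) + B))` whenever
`∫_{t₁}^t k²/(T−τ) dτ ≤ r² log((T−t₁)/(T−t)) + B` and `c ≥ 0`. [folklore] -/
theorem lintegral_Ioc_coeff_le_of_logMean {k : ℝ → ℝ} {T t₁ t c r B : ℝ} (hkm : Measurable k)
    (hk01 : ∀ τ, 0 ≤ k τ ∧ k τ ≤ 1) (ht₁t : t₁ ≤ t) (htT : t < T) (hc : 0 ≤ c)
    (hmean : ∫ τ in t₁..t, k τ ^ 2 / (T - τ) ≤ r ^ 2 * Real.log ((T - t₁) / (T - t)) + B) :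
    ∫⁻ s in Ioc t₁ t, ENNReal.ofReal (c * (k s ^ 2 / (T - s))) ≤
      ENNReal.ofReal (c * (r ^ 2 * Real.log ((T - t₁) / (T - t)) + B)) := by
  have hii := intervalIntegrable_coeff_sq_div hkm hk01 ht₁t htT
  have hint : IntegrableOn (fun s => c * (k s ^ 2 / (T - s))) (Ioc t₁ t) volume :=
    ((intervalIntegrable_iff_integrableOn_Ioc_of_le ht₁t).1 hii).const_mul c
  have hnn : 0 ≤ᵐ[volume.restrict (Ioc t₁ t)] fun s => c * (k s ^ 2 / (T - s)) := by
    refine (ae_restrict_mem measurableSet_Ioc).mono fun s hs => ?_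
    have hTs : 0 < T - s := by linarith [hs.2]
    exact mul_nonneg hc (div_nonneg (sq_nonneg _) hTs.le)
  rw [← ofReal_integral_eq_lintegral_ofReal hint hnn]
  refine ENNReal.ofReal_le_ofReal ?_
  rw [integral_const_mul, ← intervalIntegral.integral_of_le ht₁t]
  exact mul_le_mul_of_nonneg_left hmean hc

/-- **Depleted enstrophy Grönwall against the rate, LOG-MEAN form.** Let `u` be a classical solution of the
unforced Navier–Stokes system on `ℝ³ × [0,T)` (`ν, T > 0`), Leray–Hopf from its rapidly decaying datum, with
eventual dimensionless rate `√(T−t)‖u(t,x)‖ ≤ C√ν`. Suppose that from some onset `t₁ ∈ [0,T)` a measurable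
flow-wise depletion coefficient `k : ℝ → [0,1]` works (`|∫⟪ω(t), Du(t) ω(t)⟫| ≤ k(t)·M·‖ω(t)‖₂·‖∇ω(t)‖₂` for
every bound `M` of `|u(t)|`, `t ∈ [t₁,T)`) whose log-time quadratic mean is at most `r`:
`∫_{t₁}^t k(τ)² dτ/(T−τ) ≤ r² log((T−t₁)/(T−t)) + B` for all `t ∈ [t₁, T)`. Then
`∫‖curl u(t)‖² ≤ K (T−t)^{−r²C²/2}` for some `K ≥ 0` and all `t ∈ (0,T)`.
Proof: the time-dependent-coefficient slab Grönwall `lintegral_curl_sq_le_exp_of_flowwise_coeff` with the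
coefficient `1` (Cauchy–Schwarz, `stretchingDepletion_one`) before a late onset `t₀` and `k` after it; the weight
obeys `k̃(s)²‖u(s)‖²_∞ ≤ B₀² + C²ν·k(s)²/(T−s)`, whose time integral is
`≤ B₀²T + C²ν(log(T/(T−t₁)) + max B 0 + r² log(T/(T−t)))`. [folklore] -/
theorem lintegral_curl_sq_le_rpow_of_rate_logMean {ν r T C t₁ B : ℝ} (hν : 0 < ν) (hT : 0 < T)
    (ht₁ : t₁ ∈ Ico 0 T)
    {u : ℝ → EuclideanSpace ℝ (Fin 3) → EuclideanSpace ℝ (Fin 3)}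
    {p : ℝ → EuclideanSpace ℝ (Fin 3) → ℝ}
    (hsol : IsClassicalNSSolutionOn (Ico 0 T) ν 0 u p) (hLH : IsLerayHopfOn T ν 0 (u 0) u)
    (hdec : HasRapidSpatialDecay (u 0))
    {k : ℝ → ℝ} (hkm : Measurable k) (hk01 : ∀ τ, 0 ≤ k τ ∧ k τ ≤ 1)
    (hflow : ∀ t ∈ Ico t₁ T, ∀ M : ℝ, (∀ x, ‖u t x‖ ≤ M) →
      |∫ x, ⟪curl (u t) x, fderiv ℝ (u t) x (curl (u t) x)⟫| ≤
        k t * M * Real.sqrt (∫ x, ‖curl (u t) x‖ ^ 2) *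
          Real.sqrt (∫ x, frobeniusNormSq (fderiv ℝ (curl (u t)) x)))
    (hmean : ∀ t ∈ Ico t₁ T, ∫ τ in t₁..t, k τ ^ 2 / (T - τ) ≤
      r ^ 2 * Real.log ((T - t₁) / (T - t)) + B)
    (hrate : ∀ᶠ t in 𝓝[<] T, ∀ x, Real.sqrt (T - t) * ‖u t x‖ ≤ C * Real.sqrt ν) :
    ∃ K : ℝ, 0 ≤ K ∧ ∀ t ∈ Ioo 0 T,
      ∫⁻ x, ‖curl (u t) x‖ₑ ^ 2 ≤ ENNReal.ofReal (K * (T - t) ^ (-(r ^ 2 * C ^ 2 / 2))) := by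
  -- the onset `t₀ ∈ (t₁, T)` of the rate AND of the depletion bound
  obtain ⟨a, haT, hsub⟩ := mem_nhdsLT_iff_exists_Ioo_subset.1 hrate
  set t₀ : ℝ := (max (max a (T / 2)) t₁ + T) / 2 with ht₀def
  have hmax : max (max a (T / 2)) t₁ < T := max_lt (max_lt haT (by linarith)) ht₁.2
  have hat₀ : a < t₀ := by
    have := (le_max_left a (T / 2)).trans (le_max_left (max a (T / 2)) t₁); rw [ht₀def]; linarith
  have ht₁t₀ : t₁ < t₀ := by
    have := le_max_right (max a (T / 2)) t₁; rw [ht₀def]; linarith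
  have ht₀ : t₀ ∈ Ioo 0 T := by
    have := (le_max_right a (T / 2)).trans (le_max_left (max a (T / 2)) t₁)
    rw [ht₀def]; constructor <;> linarith
  -- the spliced coefficient: Cauchy–Schwarz before `t₀`, the flow-wise `k` after
  set kk : ℝ → ℝ := fun s => if s < t₀ then 1 else k s with hkkdef
  have hrate' : ∀ s ∈ Ico t₀ T, ∀ x, Real.sqrt (T - s) * ‖u s x‖ ≤ C * Real.sqrt ν :=
    fun s hs => hsub ⟨hat₀.trans_le hs.1, hs.2⟩
  -- a sup bound on `[0, t₀]` from the Tao cover at `T' = t₀`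
  obtain ⟨q₀, hsol₀, hu₀, -, -⟩ := stub_taoCover hν hT hsol hLH hdec ht₀
  obtain ⟨B₀, hB₀0, hB₀⟩ := exists_forall_norm_le_of_hasBoundedSobolevNormsOn hsol₀ hu₀
  obtain ⟨C₁, hC₁⟩ := hu₀ 1
  have hC2ν : 0 ≤ C ^ 2 * ν := by positivity
  -- the weighted sup-norm bound `kk(s)²‖u(s)‖²_∞ ≤ B₀² + C²ν · k(s)²/(T−s)` on `[0, T)`
  have hNsq : ∀ s ∈ Ico 0 T, kk s ^ 2 * (eLpNorm (u s) ⊤ volume).toReal ^ (2 : ℝ) ≤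
      B₀ ^ 2 + C ^ 2 * ν * (k s ^ 2 / (T - s)) := by
    intro s hs
    have hTs : 0 < T - s := sub_pos.2 hs.2
    have hextra : 0 ≤ C ^ 2 * ν * (k s ^ 2 / (T - s)) :=
      mul_nonneg hC2ν (div_nonneg (sq_nonneg _) hTs.le)
    rw [Real.rpow_two]
    by_cases hst : s < t₀
    · have hks : kk s = 1 := by rw [hkkdef]; simp only; rw [if_pos hst]
      have h1 : (eLpNorm (u s) ⊤ volume).toReal ≤ B₀ :=
        toReal_eLpNorm_top_le_of_bound hB₀0 (hB₀ s ⟨hs.1, hst.le⟩)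
      rw [hks, one_pow, one_mul]
      nlinarith [ENNReal.toReal_nonneg (a := eLpNorm (u s) ⊤ volume)]
    · have hks : kk s = k s := by rw [hkkdef]; simp only; rw [if_neg hst]
      have hb : 0 ≤ Real.sqrt (C ^ 2 * ν / (T - s)) := Real.sqrt_nonneg _
      have h1 : ∀ x, ‖u s x‖ ≤ Real.sqrt (C ^ 2 * ν / (T - s)) := fun x =>
        Real.le_sqrt_of_sq_le
          (sq_norm_le_of_rate_mul hν.le hs.2 (hrate' s ⟨not_lt.1 hst, hs.2⟩ x))
      have h2 : (eLpNorm (u s) ⊤ volume).toReal ≤ Real.sqrt (C ^ 2 * ν / (T - s)) :=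
        toReal_eLpNorm_top_le_of_bound hb h1
      have h3 := pow_le_pow_left₀ ENNReal.toReal_nonneg h2 2
      rw [Real.sq_sqrt (by positivity)] at h3
      rw [hks]
      have h4 := mul_le_mul_of_nonneg_left h3 (sq_nonneg (k s))
      have h5 : k s ^ 2 * (C ^ 2 * ν / (T - s)) = C ^ 2 * ν * (k s ^ 2 / (T - s)) := by ring
      nlinarith [sq_nonneg B₀]
  -- the log-mean bound on the weight integral, in `ℝ≥0∞`
  set A : ℝ := Real.log (T / (T - t₁)) + max B 0 with hAdef
  have hTt₁ : 0 < T - t₁ := sub_pos.2 ht₁.2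
  have hlog₁ : 0 ≤ Real.log (T / (T - t₁)) :=
    Real.log_nonneg ((one_le_div hTt₁).2 (by linarith [ht₁.1]))
  have hA0 : 0 ≤ A := add_nonneg hlog₁ (le_max_right _ _)
  have hI : ∀ t ∈ Ioo 0 T,
      ∫⁻ s in Ioo 0 t, ENNReal.ofReal (C ^ 2 * ν * (k s ^ 2 / (T - s))) ≤
        ENNReal.ofReal (C ^ 2 * ν * (A + r ^ 2 * Real.log (T / (T - t)))) := by
    intro t ht
    have hTt : 0 < T - t := sub_pos.2 ht.2
    have hlog : 0 ≤ Real.log (T / (T - t)) :=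
      Real.log_nonneg ((one_le_div hTt).2 (by linarith [ht.1]))
    have hr2log : 0 ≤ r ^ 2 * Real.log (T / (T - t)) := mul_nonneg (sq_nonneg _) hlog
    -- pointwise, the weight is at most `C²ν/(T−s)`
    have hpt : ∀ s ∈ Ioo 0 T, ENNReal.ofReal (C ^ 2 * ν * (k s ^ 2 / (T - s))) ≤
        ENNReal.ofReal (C ^ 2 * ν / (T - s)) := by
      intro s hs
      have hTs : 0 < T - s := sub_pos.2 hs.2
      have hk2 : k s ^ 2 ≤ 1 := by
        have h := hk01 s
        nlinarith [h.1, h.2]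
      refine ENNReal.ofReal_le_ofReal ?_
      rw [show C ^ 2 * ν / (T - s) = C ^ 2 * ν * (1 / (T - s)) by ring]
      exact mul_le_mul_of_nonneg_left (div_le_div_of_nonneg_right hk2 hTs.le) hC2ν
    by_cases htt₁ : t ≤ t₁
    · -- early times: Cauchy–Schwarz weight only
      calc ∫⁻ s in Ioo 0 t, ENNReal.ofReal (C ^ 2 * ν * (k s ^ 2 / (T - s)))
          ≤ ∫⁻ s in Ioo 0 t, ENNReal.ofReal (C ^ 2 * ν / (T - s)) :=
            setLIntegral_mono' measurableSet_Ioo fun s hs => hpt s ⟨hs.1, hs.2.trans ht.2⟩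
        _ = ENNReal.ofReal (C ^ 2 * ν * Real.log (T / (T - t))) :=
            lintegral_Ioo_div_sub_eq hC2ν ht.1.le ht.2
        _ ≤ ENNReal.ofReal (C ^ 2 * ν * (A + r ^ 2 * Real.log (T / (T - t)))) := by
            refine ENNReal.ofReal_le_ofReal (mul_le_mul_of_nonneg_left ?_ hC2ν)
            have hmono : Real.log (T / (T - t)) ≤ Real.log (T / (T - t₁)) := by
              refine Real.log_le_log (div_pos hT hTt) ?_
              exact div_le_div_of_nonneg_left hT.le hTt₁ (by linarith)
            linarith [le_max_right B 0]
    · -- late times: split at `t₁`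
      have ht₁t : t₁ < t := lt_of_not_ge htt₁
      have hsplit : Ioo 0 t ⊆ Ioo 0 t₁ ∪ Ico t₁ t := by
        intro s hs
        by_cases h : s < t₁
        · exact Or.inl ⟨hs.1, h⟩
        · exact Or.inr ⟨not_lt.1 h, hs.2⟩
      have h1 : ∫⁻ s in Ioo 0 t₁, ENNReal.ofReal (C ^ 2 * ν * (k s ^ 2 / (T - s))) ≤
          ENNReal.ofReal (C ^ 2 * ν * Real.log (T / (T - t₁))) := by
        calc ∫⁻ s in Ioo 0 t₁, ENNReal.ofReal (C ^ 2 * ν * (k s ^ 2 / (T - s)))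
            ≤ ∫⁻ s in Ioo 0 t₁, ENNReal.ofReal (C ^ 2 * ν / (T - s)) :=
              setLIntegral_mono' measurableSet_Ioo fun s hs => hpt s ⟨hs.1, hs.2.trans ht₁.2⟩
          _ = ENNReal.ofReal (C ^ 2 * ν * Real.log (T / (T - t₁))) :=
              lintegral_Ioo_div_sub_eq hC2ν ht₁.1 ht₁.2
      have h2 : ∫⁻ s in Ico t₁ t, ENNReal.ofReal (C ^ 2 * ν * (k s ^ 2 / (T - s))) ≤
          ENNReal.ofReal (C ^ 2 * ν * (r ^ 2 * Real.log ((T - t₁) / (T - t)) + B)) := by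
        rw [setLIntegral_congr Ico_ae_eq_Ioc]
        exact lintegral_Ioc_coeff_le_of_logMean hkm hk01 ht₁t.le ht.2 hC2ν (hmean t ⟨ht₁t.le, ht.2⟩)
      have hB' : r ^ 2 * Real.log ((T - t₁) / (T - t)) + B ≤
          max B 0 + r ^ 2 * Real.log (T / (T - t)) := by
        have hmono : Real.log ((T - t₁) / (T - t)) ≤ Real.log (T / (T - t)) := by
          refine Real.log_le_log (div_pos hTt₁ hTt) ?_
          exact div_le_div_of_nonneg_right (by linarith [ht₁.1]) hTt.le
        nlinarith [le_max_left B 0, sq_nonneg r]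
      have hB'0 : 0 ≤ max B 0 + r ^ 2 * Real.log (T / (T - t)) :=
        add_nonneg (le_max_right _ _) hr2log
      calc ∫⁻ s in Ioo 0 t, ENNReal.ofReal (C ^ 2 * ν * (k s ^ 2 / (T - s)))
          ≤ ∫⁻ s in Ioo 0 t₁ ∪ Ico t₁ t, ENNReal.ofReal (C ^ 2 * ν * (k s ^ 2 / (T - s))) :=
            lintegral_mono_set hsplit
        _ ≤ (∫⁻ s in Ioo 0 t₁, ENNReal.ofReal (C ^ 2 * ν * (k s ^ 2 / (T - s)))) +
              ∫⁻ s in Ico t₁ t, ENNReal.ofReal (C ^ 2 * ν * (k s ^ 2 / (T - s))) :=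
            lintegral_union_le _ _ _
        _ ≤ ENNReal.ofReal (C ^ 2 * ν * Real.log (T / (T - t₁))) +
              ENNReal.ofReal (C ^ 2 * ν * (max B 0 + r ^ 2 * Real.log (T / (T - t)))) := by
            exact add_le_add h1
              (h2.trans (ENNReal.ofReal_le_ofReal (mul_le_mul_of_nonneg_left hB' hC2ν)))
        _ = ENNReal.ofReal (C ^ 2 * ν * (A + r ^ 2 * Real.log (T / (T - t)))) := by
            rw [← ENNReal.ofReal_add (mul_nonneg hC2ν hlog₁) (mul_nonneg hC2ν hB'0), hAdef]
            ring_nf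
  -- the integrated bound `Λ_kk(t) ≤ B₀²T + C²ν (A + r² log(T/(T−t)))`
  have hΛ : ∀ t ∈ Ioo 0 T,
      ∫⁻ s in Ioo 0 t, ENNReal.ofReal (kk s ^ 2 * (eLpNorm (u s) ⊤ volume).toReal ^ (2 : ℝ)) ≤
        ENNReal.ofReal (B₀ ^ 2 * T + C ^ 2 * ν * (A + r ^ 2 * Real.log (T / (T - t)))) := by
    intro t ht
    have hTt : 0 < T - t := sub_pos.2 ht.2
    have hlog : 0 ≤ Real.log (T / (T - t)) :=
      Real.log_nonneg ((one_le_div hTt).2 (by linarith [ht.1]))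
    have hin0 : 0 ≤ C ^ 2 * ν * (A + r ^ 2 * Real.log (T / (T - t))) :=
      mul_nonneg hC2ν (add_nonneg hA0 (mul_nonneg (sq_nonneg _) hlog))
    calc ∫⁻ s in Ioo 0 t, ENNReal.ofReal (kk s ^ 2 * (eLpNorm (u s) ⊤ volume).toReal ^ (2 : ℝ))
        ≤ ∫⁻ s in Ioo 0 t, (ENNReal.ofReal (B₀ ^ 2) +
            ENNReal.ofReal (C ^ 2 * ν * (k s ^ 2 / (T - s)))) := by
          refine setLIntegral_mono' measurableSet_Ioo fun s hs => ?_
          have hTs : 0 < T - s := by linarith [hs.2, ht.2]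
          rw [← ENNReal.ofReal_add (sq_nonneg _)
            (mul_nonneg hC2ν (div_nonneg (sq_nonneg _) hTs.le))]
          exact ENNReal.ofReal_le_ofReal (hNsq s ⟨hs.1.le, hs.2.trans ht.2⟩)
      _ = ENNReal.ofReal (B₀ ^ 2) * volume (Ioo 0 t) +
            ∫⁻ s in Ioo 0 t, ENNReal.ofReal (C ^ 2 * ν * (k s ^ 2 / (T - s))) := by
          rw [lintegral_add_left measurable_const, setLIntegral_const]
      _ ≤ ENNReal.ofReal (B₀ ^ 2 * t) +
            ENNReal.ofReal (C ^ 2 * ν * (A + r ^ 2 * Real.log (T / (T - t)))) := by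
          rw [Real.volume_Ioo, sub_zero, ← ENNReal.ofReal_mul (sq_nonneg _)]
          exact add_le_add le_rfl (hI t ht)
      _ = ENNReal.ofReal (B₀ ^ 2 * t + C ^ 2 * ν * (A + r ^ 2 * Real.log (T / (T - t)))) :=
          (ENNReal.ofReal_add (mul_nonneg (sq_nonneg _) ht.1.le) hin0).symm
      _ ≤ ENNReal.ofReal (B₀ ^ 2 * T + C ^ 2 * ν * (A + r ^ 2 * Real.log (T / (T - t)))) := by
          refine ENNReal.ofReal_le_ofReal ?_
          nlinarith [sq_nonneg B₀, ht.2]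
  -- finiteness of the enstrophy at time `0`
  have h00 : (0 : ℝ) ∈ Icc 0 t₀ := ⟨le_rfl, ht₀.1.le⟩
  have hZ0 : ∫⁻ x, ‖curl (u 0) x‖ₑ ^ 2 ≤ 6 * C₁ := by
    calc ∫⁻ x, ‖curl (u 0) x‖ₑ ^ 2 ≤ ∫⁻ x, 6 * ‖iteratedFDeriv ℝ 1 (u 0) x‖ₑ ^ 2 :=
          lintegral_mono fun x => enorm_curl_sq_le_six_mul (u 0) x
      _ = 6 * ∫⁻ x, ‖iteratedFDeriv ℝ 1 (u 0) x‖ₑ ^ 2 := lintegral_const_mul' _ _ (by norm_num)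
      _ ≤ 6 * C₁ := by gcongr; exact hC₁ 0 h00
  have hZ0top : ∫⁻ x, ‖curl (u 0) x‖ₑ ^ 2 ≠ ⊤ :=
    (hZ0.trans_lt (ENNReal.mul_lt_top (by norm_num) ENNReal.coe_lt_top)).ne
  set Z0 : ℝ := (∫⁻ x, ‖curl (u 0) x‖ₑ ^ 2).toReal with hZ0def
  have hZ0nn : 0 ≤ Z0 := ENNReal.toReal_nonneg
  -- the constant
  set kν : ℝ := 1 / (2 * ν) with hkν
  have hkν0 : 0 ≤ kν := by positivity
  set γ : ℝ := r ^ 2 * C ^ 2 / 2 with hγ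
  have hγk : kν * (C ^ 2 * ν * r ^ 2) = γ := by
    rw [hkν, hγ]
    field_simp
  set K : ℝ := Real.exp (kν * (B₀ ^ 2 * T + C ^ 2 * ν * A)) * T ^ γ * Z0 with hK
  refine ⟨K, by positivity, fun t ht => ?_⟩
  obtain ⟨q, hsolt, hut, hutt, -⟩ := stub_taoCover hν hT hsol hLH hdec ht
  have hTt : 0 < T - t := sub_pos.2 ht.2
  have hΛt := hΛ t ht
  have hΛtop : ∫⁻ s in Ioo 0 t,
      ENNReal.ofReal (kk s ^ 2 * (eLpNorm (u s) ⊤ volume).toReal ^ (2 : ℝ)) ≠ ⊤ :=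
    (hΛt.trans_lt ENNReal.ofReal_lt_top).ne
  have hflow_t : ∀ s ∈ Icc 0 t, ∀ M : ℝ, (∀ x, ‖u s x‖ ≤ M) →
      |∫ x, ⟪curl (u s) x, fderiv ℝ (u s) x (curl (u s) x)⟫| ≤
        kk s * M * Real.sqrt (∫ x, ‖curl (u s) x‖ ^ 2) *
          Real.sqrt (∫ x, frobeniusNormSq (fderiv ℝ (curl (u s)) x)) := by
    intro s hs M hM
    by_cases hst : s < t₀
    · have hks : kk s = 1 := by rw [hkkdef]; simp only; rw [if_pos hst]
      obtain ⟨iZ, iA, iJ⟩ := slice_integrability hsolt hut hs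
      have hsI : s ∈ Icc 0 t := hs
      rw [hks]
      exact stretchingDepletion_one (u s) M ((hsolt.contDiff_velocity hsI).of_le (by norm_cast))
        (hsolt.divFree s hsI) hM iZ iA iJ
    · have hks : kk s = k s := by rw [hkkdef]; simp only; rw [if_neg hst]
      rw [hks]
      exact hflow s ⟨ht₁t₀.le.trans (not_lt.1 hst), hs.2.trans_lt ht.2⟩ M hM
  have hmain := lintegral_curl_sq_le_exp_of_flowwise_coeff hν ht.1 hsolt kk hflow_t hut hutt
    ⟨ht.1, le_rfl⟩ hΛtop
  refine hmain.trans ?_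
  have hlog : 0 ≤ Real.log (T / (T - t)) :=
    Real.log_nonneg ((one_le_div hTt).2 (by linarith [ht.1]))
  have hrhs0 : 0 ≤ B₀ ^ 2 * T + C ^ 2 * ν * (A + r ^ 2 * Real.log (T / (T - t))) :=
    add_nonneg (by positivity) (mul_nonneg hC2ν (add_nonneg hA0 (mul_nonneg (sq_nonneg _) hlog)))
  have hexp : Real.exp (1 / (2 * ν) *
      (∫⁻ s in Ioo 0 t,
        ENNReal.ofReal (kk s ^ 2 * (eLpNorm (u s) ⊤ volume).toReal ^ (2 : ℝ))).toReal) ≤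
      Real.exp (kν * (B₀ ^ 2 * T + C ^ 2 * ν * A)) * (T / (T - t)) ^ γ := by
    have h1 : (∫⁻ s in Ioo 0 t,
        ENNReal.ofReal (kk s ^ 2 * (eLpNorm (u s) ⊤ volume).toReal ^ (2 : ℝ))).toReal ≤
        B₀ ^ 2 * T + C ^ 2 * ν * (A + r ^ 2 * Real.log (T / (T - t))) :=
      ENNReal.toReal_le_of_le_ofReal hrhs0 hΛt
    have h2 := Real.exp_le_exp.2 (mul_le_mul_of_nonneg_left h1 hkν0)
    refine h2.trans_eq ?_
    rw [show B₀ ^ 2 * T + C ^ 2 * ν * (A + r ^ 2 * Real.log (T / (T - t))) =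
        (B₀ ^ 2 * T + C ^ 2 * ν * A) + (C ^ 2 * ν * r ^ 2) * Real.log (T / (T - t)) by ring,
      exp_mul_add_mul_log (div_pos hT hTt), hγk]
  have hpow : (T / (T - t)) ^ γ = T ^ γ * (T - t) ^ (-γ) := by
    rw [Real.div_rpow hT.le hTt.le, Real.rpow_neg hTt.le, div_eq_mul_inv]
  calc ENNReal.ofReal (Real.exp (1 / (2 * ν) *
        (∫⁻ s in Ioo 0 t,
          ENNReal.ofReal (kk s ^ 2 * (eLpNorm (u s) ⊤ volume).toReal ^ (2 : ℝ))).toReal)) *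
        ∫⁻ x, ‖curl (u 0) x‖ₑ ^ 2
      ≤ ENNReal.ofReal (Real.exp (kν * (B₀ ^ 2 * T + C ^ 2 * ν * A)) * (T / (T - t)) ^ γ) *
          ENNReal.ofReal Z0 := by
        rw [ENNReal.ofReal_toReal hZ0top]
        gcongr
    _ = ENNReal.ofReal (K * (T - t) ^ (-γ)) := by
        rw [← ENNReal.ofReal_mul (by positivity), hpow, hK]
        ring_nf


end Summit.NavierStokesRegularity.NavierStokesRegularity.Theorems.DepletionLadder

end
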